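import Summits.HubbardSuperconductivity.HubbardSuperconductivity.Theorems.AnisotropyChordStiffnessVariationalResponse

/-!
# Route `AnisotropyChord` / H0 rotor rung: the chain's conclusion in the ROUTE'S OWN CURRENCY
# `Λ(ψ) = Re⟨ψ, S⁺_tot S⁻_tot ψ⟩` (the order parameter of `FerroSideChord` / `ChordFM`, stmt-19089)

`EventualCondensate Δ M` speaks about the amplitude functional `condensateDensity` of Perron sector amplitudes.  This file
identifies it with the operator expression used by the route's statement items:
* `lowerOn_mulVec_toC_apply` : `(S⁻_tot ψ)(τ) = lowerSum a τ` for `ψ = toC a`;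
* `star_dotProduct_raiseLower_toC` : `⟨ψ, S⁺_tot S⁻_tot ψ⟩ = ‖S⁻_tot ψ‖² = lowerNormSq a`;
* `lambda_eq_lowerNormSq_of_sectorGround` : for EVERY normalised sector ground state `ψ` (complex, any phase),
  `Re⟨ψ, S⁺_tot S⁻_tot ψ⟩ = lowerNormSq a = L⁴ · condensateDensity a` of the sector's Perron amplitude `a`
  (Perron uniqueness, `sectorGround_eq_smul_perron`);
* **`eventual_lambda_ge_of_eventualCondensate`** : `EventualCondensate Δ M ⇒ ∃ c > 0, ∀ᶠ L, ∀` normalised sector-`M_L`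
  ground states `ψ` of `H(Δ)`: `c · L⁴ ≤ Re⟨ψ, (Σ_x S⁺_x)(Σ_y S⁻_y) ψ⟩` — the literal shape of the route's order-parameter
  bounds (`Λ ≥ const · S(S+1)`, `S = L²/2`);
* **`eventual_lambda_ge_of_variational_hypotheses`** : the whole one-state H0 chain in that currency:
  `ρ_L → ρ ∈ (0,1) → VariationalTwistStiffnessN Δ M → VariationalDensityResponseN Δ M → TeleGaussianComparison Δ M →
   ∃ c > 0, ∀ᶠ L, ∀ ψ (normalised sector GS), c·L⁴ ≤ Λ(ψ)`.
-/

set_option linter.dupNamespace false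

noncomputable section

open Matrix Complex Finset Filter Topology
open scoped ComplexConjugate
open Literature.MathematicalPhysics.QuantumLattice hiding torusPhase torusNorm
open Literature.Probability.LatticeModels
open Summit.HubbardSuperconductivity.HubbardSuperconductivity.Theorems.AnisotropyChord.InsertionEntropy

namespace Summit.HubbardSuperconductivity.HubbardSuperconductivity.Theorems.AnisotropyChord.Stiffness

variable {L : ℕ} [NeZero L]

/-- **`(S⁻_tot ψ)(τ) = lowerSum a τ`** for the real amplitude vector `ψ = toC a`. [folklore] -/
theorem lowerOn_mulVec_toC_apply (a : TensorIndex (TorusSite 2 L) 2 → ℝ) (τ : TensorIndex (TorusSite 2 L) 2) :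
    (lowerOn 1 (Finset.univ : Finset (TorusSite 2 L)) *ᵥ toC L a) τ = ((lowerSum a τ : ℝ) : ℂ) := by
  unfold lowerOn lowerSum toC
  rw [Matrix.sum_mulVec, Finset.sum_apply]
  push_cast
  refine Finset.sum_congr rfl fun x _ => ?_
  rw [LiebMattis.onSite_mulVec_apply]
  -- entries of the spin-½ lowering operator: `⟨1|S⁻|0⟩ = 1`, all others `0` (tree
  -- `LatticeCoherence.spinLower_one_apply` in the BEC summit; recomputed locally to keep the import cone small)
  have hsl : ∀ k l : Fin 2, spinLower 1 k l = if k = 1 ∧ l = 0 then 1 else 0 := by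
    intro k l
    rw [spinLower, conjTranspose_apply, LiebMattis.star_spinRaise_apply]
    fin_cases k <;> fin_cases l <;> simp [spinRaise]
  simp only [hsl, Fin.sum_univ_two]
  by_cases h : τ x = 1
  · simp [h]
  · have h0 : τ x = 0 := by
      have fin2 : ∀ t : Fin 2, t = 0 ∨ t = 1 := by decide
      rcases fin2 (τ x) with h0 | h1
      · exact h0
      · exact absurd h1 h
    simp [h0]

/-- **`⟨ψ, S⁺_tot S⁻_tot ψ⟩ = ‖S⁻_tot ψ‖² = lowerNormSq a`** for `ψ = toC a`. [folklore] -/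
theorem star_dotProduct_raiseLower_toC (a : TensorIndex (TorusSite 2 L) 2 → ℝ) :
    star (toC L a) ⬝ᵥ (((∑ x : TorusSite 2 L, onSite x (spinRaise 1)) * (∑ y : TorusSite 2 L, onSite y (spinLower 1))
        : Op (TorusSite 2 L) 2) *ᵥ toC L a)
      = ((lowerNormSq a : ℝ) : ℂ) := by
  have hR : ((∑ x : TorusSite 2 L, onSite x (spinRaise 1)) : Op (TorusSite 2 L) 2)
      = (lowerOn 1 (Finset.univ : Finset (TorusSite 2 L)))ᴴ := by
    rw [lowerOn_eq_conjTranspose, conjTranspose_conjTranspose]; rfl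
  have hLo : ((∑ y : TorusSite 2 L, onSite y (spinLower 1)) : Op (TorusSite 2 L) 2)
      = lowerOn 1 (Finset.univ : Finset (TorusSite 2 L)) := rfl
  rw [← mulVec_mulVec, hR, hLo, dotProduct_mulVec, ← star_mulVec]
  unfold dotProduct lowerNormSq
  push_cast
  refine Finset.sum_congr rfl fun τ _ => ?_
  rw [Pi.star_apply, lowerOn_mulVec_toC_apply, RCLike.star_def, Complex.conj_ofReal]
  ring

/-- `⟨c v, A (c v)⟩ = |c|² ⟨v, A v⟩`. [folklore] -/
theorem star_smul_dotProduct_mulVec_smul {n : Type*} [Fintype n] (A : Matrix n n ℂ) (c : ℂ) (v : n → ℂ) :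
    star (c • v) ⬝ᵥ (A *ᵥ (c • v)) = (starRingEnd ℂ) c * c * (star v ⬝ᵥ (A *ᵥ v)) := by
  rw [star_smul, mulVec_smul, smul_dotProduct, dotProduct_smul, smul_eq_mul, smul_eq_mul, RCLike.star_def]
  ring

/-- **Every normalised sector ground state has the Perron state's order parameter:**
`Re⟨ψ, S⁺_tot S⁻_tot ψ⟩ = lowerNormSq a` (`ψ = c·toC a` with `|c| = 1` by Perron uniqueness). [folklore] -/
theorem lambda_eq_lowerNormSq_of_sectorGround (Δ M : ℝ) (a : TensorIndex (TorusSite 2 L) 2 → ℝ)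
    (ha : IsPerronSectorGroundAmplitude L Δ M a) (ψ : TensorIndex (TorusSite 2 L) 2 → ℂ)
    (hψK : ψ ∈ spinZSector (Λ := TorusSite 2 L) 1 M) (hψ1 : star ψ ⬝ᵥ ψ = 1)
    (hHψ : hcbHamiltonian L Δ *ᵥ ψ = ((lowestEnergyInSector 1 (hcbHamiltonian L Δ) M : ℝ) : ℂ) • ψ) :
    (star ψ ⬝ᵥ (((∑ x : TorusSite 2 L, onSite x (spinRaise 1)) * (∑ y : TorusSite 2 L, onSite y (spinLower 1))
        : Op (TorusSite 2 L) 2) *ᵥ ψ)).re = lowerNormSq a := by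
  obtain ⟨c, hc⟩ := sectorGround_eq_smul_perron L Δ M a ha hψK hHψ
  have hunit : star (toC L a) ⬝ᵥ toC L a = 1 := by
    unfold dotProduct toC
    simp only [Pi.star_apply, RCLike.star_def, Complex.conj_ofReal]
    rw [show (∑ σ, (a σ : ℂ) * (a σ : ℂ)) = (((∑ σ, a σ ^ 2 : ℝ)) : ℂ) by push_cast; simp [sq], ha.unit]
    simp
  have hcc : (starRingEnd ℂ) c * c = 1 := by
    have h := hψ1
    rw [hc, star_smul, smul_dotProduct, dotProduct_smul, smul_eq_mul, smul_eq_mul, RCLike.star_def, hunit,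
      mul_one] at h
    exact h
  rw [hc, star_smul_dotProduct_mulVec_smul, hcc, one_mul, star_dotProduct_raiseLower_toC, Complex.ofReal_re]

/-- **`EventualCondensate` in the route's currency (PROVED link):** a uniform condensate-density floor gives
`∃ c > 0, ∀ᶠ L, ∀` normalised sector-`M_L` ground states `ψ` of `H(Δ)`:  `c · L⁴ ≤ Re⟨ψ, (Σ_x S⁺_x)(Σ_y S⁻_y) ψ⟩`. [folklore] -/
theorem eventual_lambda_ge_of_eventualCondensate (Δ : ℝ) (M : ℕ → ℝ) (hE : EventualCondensate Δ M) :
    ∃ c > (0 : ℝ), ∀ᶠ L : ℕ in atTop, ∀ [NeZero L], ∀ ψ : TensorIndex (TorusSite 2 L) 2 → ℂ,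
      ψ ∈ spinZSector (Λ := TorusSite 2 L) 1 (M L) → star ψ ⬝ᵥ ψ = 1 →
        hcbHamiltonian L Δ *ᵥ ψ = ((lowestEnergyInSector 1 (hcbHamiltonian L Δ) (M L) : ℝ) : ℂ) • ψ →
          c * (L : ℝ) ^ 4 ≤ (star ψ ⬝ᵥ (((∑ x : TorusSite 2 L, onSite x (spinRaise 1))
              * (∑ y : TorusSite 2 L, onSite y (spinLower 1)) : Op (TorusSite 2 L) 2) *ᵥ ψ)).re := by
  obtain ⟨c, hc, hev⟩ := hE
  refine ⟨c, hc, ?_⟩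
  filter_upwards [hev] with L hL
  intro _ ψ hψK hψ1 hHψ
  -- the sector is non-trivial, so it carries a Perron amplitude
  have hψ0 : ψ ≠ 0 := by
    intro h0; rw [h0, dotProduct_zero] at hψ1; exact zero_ne_one hψ1
  have hK : spinZSector (Λ := TorusSite 2 L) 1 (M L) ≠ ⊥ := by
    intro hbot; rw [hbot, Submodule.mem_bot] at hψK; exact hψ0 hψK
  obtain ⟨a, ha⟩ := exists_perronAmplitude L Δ (M L) hK
  rw [lambda_eq_lowerNormSq_of_sectorGround Δ (M L) a ha ψ hψK hψ1 hHψ]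
  have hcd := hL a ha
  have hcard : (Fintype.card (TorusSite 2 L) : ℝ) = (L : ℝ) ^ 2 := by
    rw [Fintype.card_fun, ZMod.card, Fintype.card_fin]; push_cast; ring
  have hL0 : (0 : ℝ) < (L : ℝ) := by exact_mod_cast Nat.pos_of_ne_zero (NeZero.ne L)
  unfold condensateDensity at hcd
  rw [hcard, le_div_iff₀ (by positivity)] at hcd
  calc c * (L : ℝ) ^ 4 = c * ((L : ℝ) ^ 2) ^ 2 := by ring
    _ ≤ lowerNormSq a := hcd

/-- **THE ONE-STATE H0 ROTOR CHAIN IN THE ROUTE'S CURRENCY:** along `ρ_L → ρ ∈ (0,1)`, variational twist stiffness on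
both axes + variational bounded density response + Gaussian domination of one conditional pair ⇒
`∃ c > 0`, eventually every normalised sector-`M_L` ground state of `H(Δ)` has `Re⟨ψ, S⁺_tot S⁻_tot ψ⟩ ≥ c·L⁴`
(off-diagonal long-range order at the `S(S+1)` scale, `S = L²/2`). [folklore] -/
theorem eventual_lambda_ge_of_variational_hypotheses (Δ : ℝ) (M : ℕ → ℝ) (ρ : ℝ)
    (hρ : ρ ∈ Set.Ioo (0 : ℝ) 1)
    (hlim : Tendsto (fun L : ℕ => 1 / 2 + M L / (L : ℝ) ^ 2) atTop (nhds ρ))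
    (hS : VariationalTwistStiffnessN Δ M) (hK : VariationalDensityResponseN Δ M)
    (hG : TeleGaussianComparison Δ M) :
    ∃ c > (0 : ℝ), ∀ᶠ L : ℕ in atTop, ∀ [NeZero L], ∀ ψ : TensorIndex (TorusSite 2 L) 2 → ℂ,
      ψ ∈ spinZSector (Λ := TorusSite 2 L) 1 (M L) → star ψ ⬝ᵥ ψ = 1 →
        hcbHamiltonian L Δ *ᵥ ψ = ((lowestEnergyInSector 1 (hcbHamiltonian L Δ) (M L) : ℝ) : ℂ) • ψ →
          c * (L : ℝ) ^ 4 ≤ (star ψ ⬝ᵥ (((∑ x : TorusSite 2 L, onSite x (spinRaise 1))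
              * (∑ y : TorusSite 2 L, onSite y (spinLower 1)) : Op (TorusSite 2 L) 2) *ᵥ ψ)).re :=
  eventual_lambda_ge_of_eventualCondensate Δ M
    (eventualCondensate_of_oneState_variational_hypotheses Δ M ρ hρ hlim hS hK hG)

end Summit.HubbardSuperconductivity.HubbardSuperconductivity.Theorems.AnisotropyChord.Stiffness
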